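import Mathlib
import Summits.ResolutionOfSingularities.ResolutionOfSingularities.Theorems.EquisingularLiftDefs
import Summits.ResolutionOfSingularities.ResolutionOfSingularities.Theorems.EquisingularLiftEquisingularLiftSmoothNhdOfGoodAt
import Literature.AlgebraicGeometry.Motives.FiberStalk
import Literature.AlgebraicGeometry.Resolution.RegularLocalRingsJacobian
import HarnessLib

/-!
# Regular ambient with regular special fibre has good reduction

Helper `goodAt_of_isRegularLocalRing_fibre` (sub-goal G4 of the registered stub
`stub_resolveOnePoint_dimOne`) of the line `strata-split` for the crux `EquisingularLift`
(stmt-ResolutionOfSingularities-15660).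

Let `O` be a discrete valuation ring with uniformizer `ϖ` and residue field `κ = O/(ϖ)`, let
`r : P' → Spec O` and `y ∈ P'`. Suppose that `𝒪_{P',y}` is a regular local ring, that the germ `g`
at `y` of the global section `r♯(ϖ)` is non-zero, and that the special fibre
`P'_s = P' ×_{Spec O} Spec κ` (Mathlib's chosen pull-back along `Spec κ → Spec O`) has a regular local
ring at every point lying over `y`. Then `GoodAt r y`: `𝒪_{P',y}` is regular and `g ∉ 𝔪_y²`.

* If `ϖ ∉ 𝔭 := r y`, then `ϖ` is a unit of `𝒪_{Spec O, r y} = O_𝔭`, so `g` is a unit of `𝒪_{P',y}`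
  and lies outside `𝔪_y ⊇ 𝔪_y²`.
* If `ϖ ∈ r y`, then `r y` is the closed point, `𝔪_{r y} 𝒪_{P',y} = (g)`, and the local ring of
  Mathlib's fibre `r.fiber (r y) = P' ×_{Spec O} Spec κ(r y)` at `y` is `𝒪_{P',y}/(g)`
  (Liu, *Algebraic Geometry and Arithmetic Curves*, Ch. 4, proof of Thm. 3.36; tree
  `Literature.AlgebraicGeometry.Motives.nonempty_stalkFiber_ringEquiv_asFiber`). As `κ(r y) ≅ κ`
  over `O`, this fibre is isomorphic over `P'` to the special fibre `P'_s`, whose local rings over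
  `y` are regular by hypothesis. So `𝒪_{P',y}/(g)` is regular with `g ≠ 0`, which forces
  `g ∉ 𝔪_y²` (Matsumura, *Commutative Ring Theory*, Thm. 14.2; tree
  `not_isRegularLocalRing_quotient_span_singleton_of_mem_sq`).

References: H. Matsumura, *Commutative Ring Theory*, CUP 1986, Thm. 14.2;
Q. Liu, *Algebraic Geometry and Arithmetic Curves*, OUP 2002, Ch. 4, Thm. 3.36.
-/

set_option linter.dupNamespace false -- mandated namespace of this single-conjunct summit
set_option linter.overlappingInstances false -- the registered signature carries both [IsDomain O] and [IsDiscreteValuationRing O] (Mathlib's class takes the former as a parameter)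

namespace Summit.ResolutionOfSingularities.ResolutionOfSingularities.Cruxes.EquisingularLift.StrataSplit

open CategoryTheory CategoryTheory.Limits AlgebraicGeometry TopologicalSpace
open IsLocalRing Literature.AlgebraicGeometry.Resolution
open Summit.ResolutionOfSingularities.ResolutionOfSingularities.Theses.EquisingularLift.Split

/-- For a local ring `O` and a point `p` of `Spec O` whose prime is the maximal ideal, the residue
field `κ(p)` of the scheme `Spec O` at `p` is `O/𝔪` over `O`: there is an isomorphism
`ε : O/𝔪 ≅ κ(p)` with `Spec ε ≫ Spec (O → O/𝔪) = (Spec O).fromSpecResidueField p`. -/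
theorem exists_iso_residueField_of_asIdeal_eq (O : Type) [CommRing O] [IsLocalRing O]
    (p : ↥(Spec (.of O))) (hp : p.asIdeal = maximalIdeal O) :
    ∃ ε : CommRingCat.of (ResidueField O) ≅ (Spec (.of O)).residueField p,
      Spec.map ε.hom ≫ Spec.map (CommRingCat.ofHom (residue O)) =
        (Spec (.of O)).fromSpecResidueField p := by
  haveI : p.asIdeal.IsMaximal := hp ▸ IsLocalRing.maximalIdeal.isMaximal O
  let e1 : ResidueField O ≃+* O ⧸ p.asIdeal := Ideal.quotEquivOfEq hp.symm
  let e2 : (O ⧸ p.asIdeal) ≃+* p.asIdeal.ResidueField :=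
    RingEquiv.ofBijective _ (Ideal.bijective_algebraMap_quotient_residueField p.asIdeal)
  refine ⟨(e1.trans e2).toCommRingCatIso ≪≫ (Scheme.Spec.residueFieldIso (.of O) p).symm, ?_⟩
  rw [← Scheme.Spec.map_residueFieldIso_inv_eq_fromSpecResidueField, ← Spec.map_comp,
    ← Spec.map_comp, Iso.trans_hom, Iso.symm_hom, ← Category.assoc, RingEquiv.toCommRingCatIso_hom,
    ← CommRingCat.ofHom_comp]
  exact congrArg (fun g => Spec.map (CommRingCat.ofHom g ≫ _)) (RingHom.ext fun a => by
    change e2 (Ideal.quotEquivOfEq hp.symm (Ideal.Quotient.mk (maximalIdeal O) a)) =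
      algebraMap O p.asIdeal.ResidueField a
    rw [Ideal.quotEquivOfEq_mk]
    rfl)

/-- For `r : P' → Spec O` over a local ring `O` and a point `y ∈ P'` over the closed point, the
special fibre `P' ×_{Spec O} Spec (O/𝔪)` (Mathlib's chosen pull-back) has a point `z` over `y`
whose local ring is that of Mathlib's fibre `r.fiber (r y) = P' ×_{Spec O} Spec κ(r y)` at `y`
(the two fibres are isomorphic over `P'`, as `κ(r y) ≅ O/𝔪` over `O`). -/
theorem exists_point_specialFibre_stalk_ringEquiv (O : Type) [CommRing O] [IsLocalRing O]
    (P' : Scheme.{0}) (r : P' ⟶ Spec (.of O)) (y : P') (hpy : (r y).asIdeal = maximalIdeal O) :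
    ∃ z : ↥(pullback r (Spec.map (CommRingCat.ofHom (residue O)))),
      pullback.fst r (Spec.map (CommRingCat.ofHom (residue O))) z = y ∧
      Nonempty (((pullback r (Spec.map (CommRingCat.ofHom (residue O)))).presheaf.stalk z) ≃+*
        (r.fiber (r y)).presheaf.stalk (r.asFiber y)) := by
  obtain ⟨ε, hε⟩ := exists_iso_residueField_of_asIdeal_eq O (r y) hpy
  -- `m : r.fiber (r y) ⥲ P' ×_{Spec O} Spec (O/𝔪)` over `P'` (the source is `r.fiber (r y)` by `rfl`)
  obtain ⟨m, hm, hmi⟩ : ∃ m : pullback r ((Spec (.of O)).fromSpecResidueField (r y)) ⟶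
      pullback r (Spec.map (CommRingCat.ofHom (residue O))),
      m ≫ pullback.fst _ _ = r.fiberι (r y) ∧ IsIso m :=
    ⟨pullback.map r ((Spec (.of O)).fromSpecResidueField (r y)) r
        (Spec.map (CommRingCat.ofHom (residue O))) (𝟙 P') (Spec.map ε.hom) (𝟙 _)
        (by simp) (by rw [Category.comp_id, hε]),
      (pullback.lift_fst _ _ _).trans (Category.comp_id _), inferInstance⟩
  refine ⟨m (r.asFiber y), ?_,
    Literature.AlgebraicGeometry.Motives.nonempty_stalk_ringEquiv_of_isIso_stalkMap m (r.asFiber y) _ rfl⟩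
  have h1 := congrArg (fun φ => φ (r.asFiber y)) hm
  simp only [Scheme.Hom.comp_apply] at h1
  exact h1.trans (Scheme.Hom.fiberι_asFiber r y)

/-- **`goodAt_of_isRegularLocalRing_fibre`.** Let `O` be a discrete valuation ring, `r : P' → Spec O`
and `y ∈ P'` with `𝒪_{P',y}` regular, the germ at `y` of every uniformizer `ϖ` non-zero, and the
special fibre `P' ×_{Spec O} Spec (O/𝔪)` regular at every point over `y`. Then `GoodAt r y`: for a
uniformizer `ϖ`, either `ϖ ∉ r y` and its germ `g` at `y` is a unit, or `r y` is the closed point and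
`𝒪_{P',y}/(g)` is the (regular) local ring of the special fibre at the point over `y`, so that
`g ∉ 𝔪_y²` by Matsumura's Thm. 14.2 (`0 ≠ g ∈ 𝔪²` would make `𝒪_{P',y}/(g)` non-regular).
[cite: Matsumura1987, Thm. 14.2] -/
theorem goodAt_of_isRegularLocalRing_fibre : ∀ (O : Type) [CommRing O] [IsDomain O] [IsDiscreteValuationRing O] (P' : AlgebraicGeometry.Scheme.{0}) (r : P' ⟶ AlgebraicGeometry.Spec (.of O)) (y : P'), IsRegularLocalRing (P'.presheaf.stalk y) → (∀ ϖ : O, Irreducible ϖ → (P'.presheaf.Γgerm y).hom (r.appTop.hom ((AlgebraicGeometry.Scheme.ΓSpecIso (CommRingCat.of O)).inv.hom ϖ)) ≠ 0) → (∀ z : ↥(CategoryTheory.Limits.pullback r (AlgebraicGeometry.Spec.map (CommRingCat.ofHom (IsLocalRing.residue O)))), CategoryTheory.Limits.pullback.fst r (AlgebraicGeometry.Spec.map (CommRingCat.ofHom (IsLocalRing.residue O))) z = y → IsRegularLocalRing ((CategoryTheory.Limits.pullback r (AlgebraicGeometry.Spec.map (CommRingCat.ofHom (IsLocalRing.residue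 O)))).presheaf.stalk z)) → Summit.ResolutionOfSingularities.ResolutionOfSingularities.Theses.EquisingularLift.Split.GoodAt r y := by
  intro O _ _ _ P' r y hreg hne hfib
  refine ⟨hreg, fun ϖ hirr => ?_⟩
  haveI := hreg
  -- the local rings `R = 𝒪_{Spec O, r y} = O_{r y}` and `S = 𝒪_{P', y}`
  set R := (Spec (.of O)).presheaf.stalk (r y)
  set S := P'.presheaf.stalk y
  set g := (P'.presheaf.Γgerm y).hom (r.appTop.hom ((Scheme.ΓSpecIso (CommRingCat.of O)).inv.hom ϖ))
    with hg
  letI : Algebra R S := (r.stalkMap y).hom.toAlgebra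
  letI : Algebra O R := StructureSheaf.stalkAlgebra O (r y)
  haveI : IsLocalization.AtPrime R (r y).asIdeal := StructureSheaf.IsLocalization.to_stalk O (r y)
  -- the germ `g` is the image of `ϖ` under `O → R → S`
  have hgalg : algebraMap R S (algebraMap O R ϖ) = g := by
    rw [hg, algebraMap_stalk_eq_Γgerm]
    exact stalkMap_Γgerm_apply' r y _
  by_cases hϖ : ϖ ∈ (r y).asIdeal
  swap
  · -- `ϖ ∉ r y`: the germ is a unit
    have hu : IsUnit g := by
      rw [← hgalg]
      exact (IsLocalization.map_units R (⟨ϖ, hϖ⟩ : (r y).asIdeal.primeCompl)).map (algebraMap R S)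
    exact fun h2 => (mem_nonunits_iff.mp ((mem_maximalIdeal _).mp (Ideal.pow_le_self two_ne_zero h2))) hu
  · -- `ϖ ∈ r y`: `r y` is the closed point and `𝔪_{r y} S = (g)`
    have hpy : (r y).asIdeal = maximalIdeal O :=
      ((IsLocalRing.maximalIdeal.isMaximal O).eq_of_le (r y).isPrime.ne_top (by
        rw [hirr.maximalIdeal_eq]
        exact (Ideal.span_singleton_le_iff_mem _).mpr hϖ)).symm
    have hmR : maximalIdeal R = (maximalIdeal O).map (algebraMap O R) := by
      rw [← hpy]
      exact (IsLocalization.AtPrime.map_eq_maximalIdeal (r y).asIdeal R).symm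
    have hmap : (maximalIdeal R).map (r.stalkMap y).hom = Ideal.span {g} := by
      rw [← hgalg, hmR, hirr.maximalIdeal_eq, Ideal.map_span, Set.image_singleton, Ideal.map_span,
        Set.image_singleton]
      rfl
    -- the local ring `S/(g)` of the fibre over the closed point is regular
    obtain ⟨z, hz, ⟨ez⟩⟩ := exists_point_specialFibre_stalk_ringEquiv O P' r y hpy
    haveI := hfib z hz
    obtain ⟨e₀⟩ := Literature.AlgebraicGeometry.Motives.nonempty_stalkFiber_ringEquiv_asFiber r y
    have hq : IsRegularLocalRing (S ⧸ Ideal.span {g}) :=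
      IsRegularLocalRing.of_ringEquiv ((ez.trans e₀).trans (Ideal.quotEquivOfEq hmap))
    -- Matsumura 14.2: `0 ≠ g ∈ 𝔪²` would make `S/(g)` non-regular
    exact fun h2 => not_isRegularLocalRing_quotient_span_singleton_of_mem_sq (hne ϖ hirr) h2 hq

end Summit.ResolutionOfSingularities.ResolutionOfSingularities.Cruxes.EquisingularLift.StrataSplit
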